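import Summits.QuantumFields.BalabanUV.Beta.GAN24.MonotoneSqueezeGauge

/-!
# `BalabanUV.Beta.GAN24.MonotoneSqueezeSlack` — binder row G-an2-4 ∕ (CONV-C), route R6 «VALUES, NOT DERIVATIVES» (the `U ≠ 1` variant): ROAD P2's SQUEEZE WITH SLACKS —
# (PROL-ε) `re⟨Pu, H_f Pu⟩ ≤ (1+ε)·re⟨u, H_c u⟩` and (MONO-ε′) `re⟨B, E_c B⟩ ≤ (1+ε′)·re⟨B, E_f B⟩` (the with-background currencies: holonomy slack of the prolongation,
# Federbush stability with mismatch) give the TWO-SIDED value step `|re⟨B,(E_f − E_c)B⟩| ≤ ((ε(1+ε′) + ε′)Λ + 2Λρ)·nsq B`, the energy distance and the energy-closeness of ANY two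
# minimiser selections `G`, `G_f` (gauge split of `MonotoneSqueezeGauge`), every slack ADDITIVE in the constant — the abstract, degenerate-form (`shortForm`) END that the
# with-background tower is to instantiate (unit b2b-balaban-gan24-p3, gen 49; v1)

NOT IN PRINT; OUR PROOF ([folklore] finite-dimensional linear algebra over `GAN24/MonotoneSqueeze` ∕ `MonotoneShorted` ∕ `MonotoneSqueezeGauge` BY NAME).  HONEST FRAMING (cell
contract, verbatim): «discharging `BetaPertH` makes Bałaban's UV stability UNCONDITIONAL — a real constructive-QFT result; it is NOT the continuum limit and NOT the Clay problem.»
HONEST DEPENDENCY (verbatim): «continuum YM on T⁴ ⇐ BetaPertH ∧ nine spine estimates (0/9 proved); BetaPertH ⇐ (D1) ∧ (D4) ∧ CAP+tail; G-an2-4 gates asym, D1 and NE2/3/4.»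

WHY.  `SPINE-TRANSPOSITION-SUPPLY-GAN24` §3 (3b)(i) (E-idea1-g27-1): route R6's NOT-IN-PRINT core is «the WITH-BACKGROUND k-rate of the effective form `Δ^{(k)}(V)` on the small-field
class (King's Lemma 4.3 twin; Fourier is unavailable at V ≠ 1)».  Road P2's Fourier-free squeeze (`MonotoneSqueeze`: (PROL) + (MONO) + row defect ⟹ value step) is stated with EXACT
(PROL) and (MONO) — true at `U = 1` only.  With a background both hold up to slacks (`T4Continuum/Support/VariationalColourFederbush.dirUv_Qcv_le`: main constant EXACTLY 1, the
background only through the mismatch `m`; route R6 PART 22 ∕ 29: holonomy slack of the prolongation), and route R6's slack ENDs (`DerivativeRateTransferLoewnerKKT` §6,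
`DerivativeRateTransferSqueeze`) are written over `ℝ` with NONSINGULAR bordered matrices — unusable for the gauge-degenerate curl forms of road P4's torus avatar and of NE2's
covariant tower.  THIS FILE is the slack squeeze in the DEGENERATE letters (`shortForm` of a PSD form along a surjective averaging, over `ℂ`), with the gauge split, so that the
with-background instantiation has ONE abstract END to call; at `ε = ε′ = 0` it is `MonotoneSqueezeGauge`.

CONTENT (0 sorry, 0 `def`, nothing cited; `ε, ε′ ≥ 0`; `Λ ≥ ‖E_f‖`; `ρ² ≥ nsq (C_f P G B − B) ∕ nsq B`):
* §1 `Hf_P_mulVec_of_ker_slack` ((PROL-ε) still maps `H_c`-null vectors to `H_f`-null vectors), `shortForm_rowDefect_mulVec_eq_slack`, `rowDefect_quad_eq_slack` (the gauge split under (PROL-ε)).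
* §2 **`shortForm_step_le_slack`** (`re⟨B,E_fB⟩ − re⟨B,E_cB⟩ ≤ ε·re⟨B,E_cB⟩ − 2re⟨B,E_f δ⟩ − re⟨δ,E_f δ⟩`), **`shortForm_step_ge_slack`** (`re⟨B,E_cB⟩ − re⟨B,E_fB⟩ ≤ ε′·re⟨B,E_fB⟩`),
  **`energy_dist_slack`** (`re⟨w − h_fB, H_f(w − h_fB)⟩ ≤ (ε + ε′ + εε′)·re⟨B,E_fB⟩ − 2re⟨B,E_f δ⟩ − re⟨δ,E_f δ⟩`).
* §3 NORM FORMS: **`abs_shortForm_step_le_slack`** (`|re⟨B,(E_f − E_c)B⟩| ≤ ((ε(1+ε′) + ε′)Λ + 2Λρ)·nsq B`), **`energy_dist_minimisers_slack`**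
  (`re⟨G_fB − PGB, H_f(G_fB − PGB)⟩ ≤ (2(ε + ε′ + εε′)Λ + 4Λρ + 2Λρ²)·nsq B`).
HONEST SCOPE.  Abstract; NO with-background input ((PROL-ε), (MONO-ε′), `ρ`, `Λ` for Bałaban's `Δ^{(k)}(V)`) is proved here — they are route R6's Bałaban-class debt; at `U = 1` the
instances are `WhitneyRowDefect*`.  NOT (CONV-C), NOT D1, NOT `BetaPertH`, NOT continuum, NOT Clay; NEVER «G-an2-4 closed».
-/

noncomputable section

namespace Summit.QuantumFields.BalabanUV.Beta.GAN24.MonotoneSqueezeSlack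

open Matrix
open scoped ComplexOrder Matrix.Norms.L2Operator
open Literature.MathematicalPhysics.QuantumFieldTheory.Balaban1983to89.B5Prop11Lower (nsq nsq_nonneg)
open Summit.QuantumFields.BalabanUV.Beta.GAN24.MonotoneShorted (harmExt shortForm shortForm_quad quad_harmExt_add C_harmExt_mulVec shortForm_quad_le
  shortForm_mulVec_eq_zero_of_lift shortForm_isHermitian shortForm_posSemidef ker_pairing)
open Summit.QuantumFields.BalabanUV.Beta.GAN24.MonotoneSqueeze (rowDefect trial Cf_trial_mulVec trial_quad_re re_pairing_le_opNorm)
open Summit.QuantumFields.BalabanUV.Beta.GAN24.MonotoneSqueezeGauge (H_harmExt_sub_mulVec_eq_zero)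

variable {ι₀ ι₁ κ : Type*} [Fintype ι₀] [DecidableEq ι₀] [Fintype ι₁] [DecidableEq ι₁] [Fintype κ] [DecidableEq κ]
variable {Hc : Matrix ι₀ ι₀ ℂ} {Hf : Matrix ι₁ ι₁ ℂ}

/-! ## §1 The gauge split under (PROL-ε) -/

omit [DecidableEq ι₀] [DecidableEq ι₁] in
/-- **(PROL-ε) PRESERVES NULL VECTORS**: `re⟨Pu, H_f Pu⟩ ≤ (1+ε)·re⟨u, H_c u⟩` for all `u` and `H_c z = 0` ⟹ `H_f (P z) = 0`. [folklore] -/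
theorem Hf_P_mulVec_of_ker_slack (hHf : Hf.PosSemidef) {P : Matrix ι₁ ι₀ ℂ} {ε : ℝ}
    (hprol : ∀ u : ι₀ → ℂ, (star (P *ᵥ u) ⬝ᵥ (Hf *ᵥ (P *ᵥ u))).re ≤ (1 + ε) * (star u ⬝ᵥ (Hc *ᵥ u)).re) {z : ι₀ → ℂ} (hz : Hc *ᵥ z = 0) :
    Hf *ᵥ (P *ᵥ z) = 0 := by
  have hle := hprol z
  rw [hz, dotProduct_zero, Complex.zero_re, mul_zero] at hle
  have hnn := hHf.dotProduct_mulVec_nonneg (P *ᵥ z)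
  obtain ⟨hre, him⟩ := Complex.nonneg_iff.mp hnn
  have hq : star (P *ᵥ z) ⬝ᵥ (Hf *ᵥ (P *ᵥ z)) = 0 := by
    apply Complex.ext
    · rw [Complex.zero_re]; linarith
    · rw [Complex.zero_im]; exact him.symm
  exact (hHf.dotProduct_mulVec_zero_iff _).mp hq

section Split

variable (hHc : Hc.PosSemidef) (hHf : Hf.PosSemidef) {Cc : Matrix κ ι₀ ℂ} {Sc : Matrix ι₀ κ ℂ} {Cf : Matrix κ ι₁ ℂ} {Sf : Matrix ι₁ κ ℂ} {P : Matrix ι₁ ι₀ ℂ}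
  {G : Matrix ι₀ κ ℂ} {ε ε' : ℝ}

/-- **THE GAUGE SPLIT UNDER (PROL-ε), LINEAR FORM**: `E_f (R B) = E_f (C_f P G B − B)` for every minimiser selection `G` at `B`. [folklore] -/
theorem shortForm_rowDefect_mulVec_eq_slack (hSc : Cc * Sc = 1) (hSf : Cf * Sf = 1)
    (hprol : ∀ u : ι₀ → ℂ, (star (P *ᵥ u) ⬝ᵥ (Hf *ᵥ (P *ᵥ u))).re ≤ (1 + ε) * (star u ⬝ᵥ (Hc *ᵥ u)).re) (hG : Cc * G = 1) (B : κ → ℂ)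
    (hmin : (star (G *ᵥ B) ⬝ᵥ (Hc *ᵥ (G *ᵥ B))).re ≤ (star B ⬝ᵥ (shortForm hHc.isHermitian Cc Sc *ᵥ B)).re) :
    shortForm hHf.isHermitian Cf Sf *ᵥ (rowDefect hHc.isHermitian Cc Sc Cf P *ᵥ B)
      = shortForm hHf.isHermitian Cf Sf *ᵥ (Cf *ᵥ (P *ᵥ (G *ᵥ B)) - B) := by
  have e : rowDefect hHc.isHermitian Cc Sc Cf P *ᵥ B
      = (Cf *ᵥ (P *ᵥ (G *ᵥ B)) - B) + Cf *ᵥ (P *ᵥ (harmExt hHc.isHermitian Cc Sc *ᵥ B - G *ᵥ B)) := by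
    rw [rowDefect, sub_mulVec, one_mulVec, ← mulVec_mulVec, ← mulVec_mulVec, mulVec_sub P, mulVec_sub Cf]; abel
  rw [e, mulVec_add, shortForm_mulVec_eq_zero_of_lift hHf hSf rfl
    (Hf_P_mulVec_of_ker_slack hHf hprol (H_harmExt_sub_mulVec_eq_zero hHc hSc hG B hmin)), add_zero]

/-- **THE GAUGE SPLIT UNDER (PROL-ε), QUADRATIC FORM**: `⟨R B, E_f (R B)⟩ = ⟨δ, E_f δ⟩`, `δ = C_f P G B − B`. [folklore] -/
theorem rowDefect_quad_eq_slack (hSc : Cc * Sc = 1) (hSf : Cf * Sf = 1)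
    (hprol : ∀ u : ι₀ → ℂ, (star (P *ᵥ u) ⬝ᵥ (Hf *ᵥ (P *ᵥ u))).re ≤ (1 + ε) * (star u ⬝ᵥ (Hc *ᵥ u)).re) (hG : Cc * G = 1) (B : κ → ℂ)
    (hmin : (star (G *ᵥ B) ⬝ᵥ (Hc *ᵥ (G *ᵥ B))).re ≤ (star B ⬝ᵥ (shortForm hHc.isHermitian Cc Sc *ᵥ B)).re) :
    star (rowDefect hHc.isHermitian Cc Sc Cf P *ᵥ B) ⬝ᵥ (shortForm hHf.isHermitian Cf Sf *ᵥ (rowDefect hHc.isHermitian Cc Sc Cf P *ᵥ B))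
      = star (Cf *ᵥ (P *ᵥ (G *ᵥ B)) - B) ⬝ᵥ (shortForm hHf.isHermitian Cf Sf *ᵥ (Cf *ᵥ (P *ᵥ (G *ᵥ B)) - B)) := by
  have e : rowDefect hHc.isHermitian Cc Sc Cf P *ᵥ B
      = (Cf *ᵥ (P *ᵥ (G *ᵥ B)) - B) + Cf *ᵥ (P *ᵥ (harmExt hHc.isHermitian Cc Sc *ᵥ B - G *ᵥ B)) := by
    rw [rowDefect, sub_mulVec, one_mulVec, ← mulVec_mulVec, ← mulVec_mulVec, mulVec_sub P, mulVec_sub Cf]; abel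
  rw [shortForm_rowDefect_mulVec_eq_slack hHc hHf hSc hSf hprol hG B hmin, e, star_add, add_dotProduct,
    ker_pairing (shortForm_isHermitian hHf.isHermitian Cf Sf)
      (shortForm_mulVec_eq_zero_of_lift hHf hSf rfl (Hf_P_mulVec_of_ker_slack hHf hprol (H_harmExt_sub_mulVec_eq_zero hHc hSc hG B hmin))), add_zero]

/-! ## §2 The slack squeeze: upper comparison from (PROL-ε), lower from (MONO-ε′), and the energy distance -/

/-- **UPPER COMPARISON WITH SLACK**: under (PROL-ε) and for any minimiser selection `G` at `B`,
`re⟨B,E_fB⟩ − re⟨B,E_cB⟩ ≤ ε·re⟨B,E_cB⟩ − 2·re⟨B,E_f δ⟩ − re⟨δ,E_f δ⟩`, `δ = C_f P G B − B` (road P2's competitor `w = P·harmExt_c B − harmExt_f (R B)`). [folklore] -/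
theorem shortForm_step_le_slack (hSc : Cc * Sc = 1) (hSf : Cf * Sf = 1) (hε : 0 ≤ ε)
    (hprol : ∀ u : ι₀ → ℂ, (star (P *ᵥ u) ⬝ᵥ (Hf *ᵥ (P *ᵥ u))).re ≤ (1 + ε) * (star u ⬝ᵥ (Hc *ᵥ u)).re) (hG : Cc * G = 1) (B : κ → ℂ)
    (hmin : (star (G *ᵥ B) ⬝ᵥ (Hc *ᵥ (G *ᵥ B))).re ≤ (star B ⬝ᵥ (shortForm hHc.isHermitian Cc Sc *ᵥ B)).re) :
    (star B ⬝ᵥ (shortForm hHf.isHermitian Cf Sf *ᵥ B)).re - (star B ⬝ᵥ (shortForm hHc.isHermitian Cc Sc *ᵥ B)).re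
      ≤ ε * (star B ⬝ᵥ (shortForm hHc.isHermitian Cc Sc *ᵥ B)).re
        - 2 * (star B ⬝ᵥ (shortForm hHf.isHermitian Cf Sf *ᵥ (Cf *ᵥ (P *ᵥ (G *ᵥ B)) - B))).re
        - (star (Cf *ᵥ (P *ᵥ (G *ᵥ B)) - B) ⬝ᵥ (shortForm hHf.isHermitian Cf Sf *ᵥ (Cf *ᵥ (P *ᵥ (G *ᵥ B)) - B))).re := by
  have _ := hε
  have h1 := (Complex.le_def.mp (shortForm_quad_le hHf hSf (Cf_trial_mulVec hHc.isHermitian hHf.isHermitian Cc Sc hSf P B))).1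
  rw [trial_quad_re hHc.isHermitian hHf Cc Sc hSf P B, rowDefect_quad_eq_slack hHc hHf hSc hSf hprol hG B hmin,
    shortForm_rowDefect_mulVec_eq_slack hHc hHf hSc hSf hprol hG B hmin] at h1
  have h2 := hprol (harmExt hHc.isHermitian Cc Sc *ᵥ B)
  rw [← shortForm_quad] at h2
  linarith

omit [DecidableEq ι₀] [DecidableEq ι₁] [DecidableEq κ] in
/-- **LOWER COMPARISON WITH SLACK**: (MONO-ε′) `re⟨B,E_cB⟩ ≤ (1+ε′)·re⟨B,E_fB⟩` read as `re⟨B,E_cB⟩ − re⟨B,E_fB⟩ ≤ ε′·re⟨B,E_fB⟩`. [folklore] -/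
theorem shortForm_step_ge_slack {Ec Ef : Matrix κ κ ℂ} (B : κ → ℂ)
    (hmono : (star B ⬝ᵥ (Ec *ᵥ B)).re ≤ (1 + ε') * (star B ⬝ᵥ (Ef *ᵥ B)).re) :
    (star B ⬝ᵥ (Ec *ᵥ B)).re - (star B ⬝ᵥ (Ef *ᵥ B)).re ≤ ε' * (star B ⬝ᵥ (Ef *ᵥ B)).re := by
  linarith

/-- **THE ENERGY DISTANCE WITH SLACKS** (Pythagoras on the fine fibre): under (PROL-ε), (MONO-ε′) at `B`, and a minimiser selection `G` at `B`,
`re⟨w − h_fB, H_f(w − h_fB)⟩ ≤ (ε + ε′ + εε′)·re⟨B,E_fB⟩ − 2·re⟨B,E_f δ⟩ − re⟨δ,E_f δ⟩`. [folklore] -/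
theorem energy_dist_slack (hSc : Cc * Sc = 1) (hSf : Cf * Sf = 1) (hε : 0 ≤ ε)
    (hprol : ∀ u : ι₀ → ℂ, (star (P *ᵥ u) ⬝ᵥ (Hf *ᵥ (P *ᵥ u))).re ≤ (1 + ε) * (star u ⬝ᵥ (Hc *ᵥ u)).re) (hG : Cc * G = 1) (B : κ → ℂ)
    (hmin : (star (G *ᵥ B) ⬝ᵥ (Hc *ᵥ (G *ᵥ B))).re ≤ (star B ⬝ᵥ (shortForm hHc.isHermitian Cc Sc *ᵥ B)).re)
    (hmono : (star B ⬝ᵥ (shortForm hHc.isHermitian Cc Sc *ᵥ B)).re ≤ (1 + ε') * (star B ⬝ᵥ (shortForm hHf.isHermitian Cf Sf *ᵥ B)).re) :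
    (star (trial hHc.isHermitian hHf.isHermitian Cc Sc Cf Sf P *ᵥ B - harmExt hHf.isHermitian Cf Sf *ᵥ B) ⬝ᵥ
        (Hf *ᵥ (trial hHc.isHermitian hHf.isHermitian Cc Sc Cf Sf P *ᵥ B - harmExt hHf.isHermitian Cf Sf *ᵥ B))).re
      ≤ (ε + ε' + ε * ε') * (star B ⬝ᵥ (shortForm hHf.isHermitian Cf Sf *ᵥ B)).re
        - 2 * (star B ⬝ᵥ (shortForm hHf.isHermitian Cf Sf *ᵥ (Cf *ᵥ (P *ᵥ (G *ᵥ B)) - B))).re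
        - (star (Cf *ᵥ (P *ᵥ (G *ᵥ B)) - B) ⬝ᵥ (shortForm hHf.isHermitian Cf Sf *ᵥ (Cf *ᵥ (P *ᵥ (G *ᵥ B)) - B))).re := by
  set w := trial hHc.isHermitian hHf.isHermitian Cc Sc Cf Sf P *ᵥ B with hwdef
  set hB := harmExt hHf.isHermitian Cf Sf *ᵥ B with hhB
  have hker : Cf *ᵥ (w - hB) = 0 := by
    rw [mulVec_sub, hwdef, Cf_trial_mulVec hHc.isHermitian hHf.isHermitian Cc Sc hSf P B, hhB, C_harmExt_mulVec hHf.isHermitian hSf, sub_self]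
  have hpy := quad_harmExt_add hHf Cf Sf B hker
  rw [← hhB, show hB + (w - hB) = w by abel] at hpy
  have hpy_re := congrArg Complex.re hpy
  rw [Complex.add_re, ← shortForm_quad] at hpy_re
  have hbk := trial_quad_re hHc.isHermitian hHf Cc Sc hSf P B
  rw [← hwdef, rowDefect_quad_eq_slack hHc hHf hSc hSf hprol hG B hmin, shortForm_rowDefect_mulVec_eq_slack hHc hHf hSc hSf hprol hG B hmin] at hbk
  have hpr := hprol (harmExt hHc.isHermitian Cc Sc *ᵥ B)
  rw [← shortForm_quad] at hpr
  have hEf0 : 0 ≤ (star B ⬝ᵥ (shortForm hHf.isHermitian Cf Sf *ᵥ B)).re :=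
    (Complex.nonneg_iff.mp ((shortForm_posSemidef hHf Cf Sf).dotProduct_mulVec_nonneg B)).1
  have hEc0 : 0 ≤ (star B ⬝ᵥ (shortForm hHc.isHermitian Cc Sc *ᵥ B)).re :=
    (Complex.nonneg_iff.mp ((shortForm_posSemidef hHc Cc Sc).dotProduct_mulVec_nonneg B)).1
  nlinarith [mul_le_mul_of_nonneg_left hmono hε]

/-! ## §3 Norm forms: every slack additive in the constant -/

/-- **THE TWO-SIDED VALUE STEP WITH SLACKS**: `‖E_f‖ ≤ Λ`, `nsq (C_f P G B − B) ≤ ρ²·nsq B` (`ρ ≥ 0`), (PROL-ε), (MONO-ε′) at `B` ⟹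
`|re⟨B,(E_f − E_c)B⟩| ≤ ((ε(1+ε′) + ε′)·Λ + 2Λρ)·nsq B`. [folklore] -/
theorem abs_shortForm_step_le_slack (hSc : Cc * Sc = 1) (hSf : Cf * Sf = 1) (hε : 0 ≤ ε) (hε' : 0 ≤ ε')
    (hprol : ∀ u : ι₀ → ℂ, (star (P *ᵥ u) ⬝ᵥ (Hf *ᵥ (P *ᵥ u))).re ≤ (1 + ε) * (star u ⬝ᵥ (Hc *ᵥ u)).re) (hG : Cc * G = 1) (B : κ → ℂ)
    (hmin : (star (G *ᵥ B) ⬝ᵥ (Hc *ᵥ (G *ᵥ B))).re ≤ (star B ⬝ᵥ (shortForm hHc.isHermitian Cc Sc *ᵥ B)).re)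
    (hmono : (star B ⬝ᵥ (shortForm hHc.isHermitian Cc Sc *ᵥ B)).re ≤ (1 + ε') * (star B ⬝ᵥ (shortForm hHf.isHermitian Cf Sf *ᵥ B)).re)
    {Λ ρ : ℝ} (hΛ : ‖shortForm hHf.isHermitian Cf Sf‖ ≤ Λ) (hρ : 0 ≤ ρ) (hδ : nsq (Cf *ᵥ (P *ᵥ (G *ᵥ B)) - B) ≤ ρ ^ 2 * nsq B) :
    |(star B ⬝ᵥ ((shortForm hHf.isHermitian Cf Sf - shortForm hHc.isHermitian Cc Sc) *ᵥ B)).re| ≤ ((ε * (1 + ε') + ε') * Λ + 2 * Λ * ρ) * nsq B := by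
  set Ef := shortForm hHf.isHermitian Cf Sf with hEf
  set r := Cf *ᵥ (P *ᵥ (G *ᵥ B)) - B with hr
  have hcs := re_pairing_le_opNorm Ef B r
  have hcsB := re_pairing_le_opNorm Ef B B
  have hsq : Real.sqrt (nsq r) ≤ ρ * Real.sqrt (nsq B) := by
    calc Real.sqrt (nsq r) ≤ Real.sqrt (ρ ^ 2 * nsq B) := Real.sqrt_le_sqrt hδ
      _ = ρ * Real.sqrt (nsq B) := by rw [Real.sqrt_mul (sq_nonneg _), Real.sqrt_sq hρ]
  have hΛ0 : 0 ≤ Λ := (norm_nonneg _).trans hΛ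
  have hB0 : 0 ≤ Real.sqrt (nsq B) := Real.sqrt_nonneg _
  have hr0 : 0 ≤ Real.sqrt (nsq r) := Real.sqrt_nonneg _
  have hBB : Real.sqrt (nsq B) * Real.sqrt (nsq B) = nsq B := Real.mul_self_sqrt (nsq_nonneg B)
  have hmain : |(star B ⬝ᵥ (Ef *ᵥ r)).re| ≤ Λ * ρ * nsq B := by
    calc |(star B ⬝ᵥ (Ef *ᵥ r)).re| ≤ ‖Ef‖ * Real.sqrt (nsq B) * Real.sqrt (nsq r) := hcs
      _ ≤ Λ * Real.sqrt (nsq B) * (ρ * Real.sqrt (nsq B)) := mul_le_mul (mul_le_mul_of_nonneg_right hΛ hB0) hsq hr0 (mul_nonneg hΛ0 hB0)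
      _ = Λ * ρ * (Real.sqrt (nsq B) * Real.sqrt (nsq B)) := by ring
      _ = Λ * ρ * nsq B := by rw [hBB]
  have hEB : (star B ⬝ᵥ (Ef *ᵥ B)).re ≤ Λ * nsq B := by
    have h := (abs_le.mp hcsB).2
    calc (star B ⬝ᵥ (Ef *ᵥ B)).re ≤ ‖Ef‖ * Real.sqrt (nsq B) * Real.sqrt (nsq B) := h
      _ ≤ Λ * Real.sqrt (nsq B) * Real.sqrt (nsq B) := mul_le_mul_of_nonneg_right (mul_le_mul_of_nonneg_right hΛ hB0) hB0
      _ = Λ * nsq B := by rw [mul_assoc, hBB]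
  have hup := shortForm_step_le_slack hHc hHf hSc hSf hε hprol hG B hmin
  have hlo := shortForm_step_ge_slack (ε' := ε') B hmono
  rw [← hEf, ← hr] at hup
  have hrr : 0 ≤ (star r ⬝ᵥ (Ef *ᵥ r)).re := (Complex.nonneg_iff.mp ((shortForm_posSemidef hHf Cf Sf).dotProduct_mulVec_nonneg r)).1
  have hEf0 : 0 ≤ (star B ⬝ᵥ (Ef *ᵥ B)).re := (Complex.nonneg_iff.mp ((shortForm_posSemidef hHf Cf Sf).dotProduct_mulVec_nonneg B)).1
  have hEc : (star B ⬝ᵥ (shortForm hHc.isHermitian Cc Sc *ᵥ B)).re ≤ (1 + ε') * (Λ * nsq B) :=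
    hmono.trans (mul_le_mul_of_nonneg_left hEB (by linarith))
  have hab := (abs_le.mp hmain).1
  have hB2 : 0 ≤ nsq B := nsq_nonneg B
  have hx1 : ε * (star B ⬝ᵥ (shortForm hHc.isHermitian Cc Sc *ᵥ B)).re ≤ ε * ((1 + ε') * (Λ * nsq B)) := mul_le_mul_of_nonneg_left hEc hε
  have hx2 : ε' * (star B ⬝ᵥ (Ef *ᵥ B)).re ≤ ε' * (Λ * nsq B) := mul_le_mul_of_nonneg_left hEB hε'
  have hp1 : 0 ≤ ε * (1 + ε') * Λ * nsq B := by positivity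
  have hp2 : 0 ≤ ε' * Λ * nsq B := by positivity
  have hp3 : 0 ≤ Λ * ρ * nsq B := by positivity
  rw [sub_mulVec, dotProduct_sub, Complex.sub_re, abs_le]
  constructor
  · linarith
  · linarith

/-- **THE TWO MINIMISER SELECTIONS ARE ENERGY-CLOSE, WITH SLACKS**: for a fine selection `G_f` (`C_f G_f = 1`, minimality at `B`) and a coarse selection `G` as above,
`re⟨G_fB − PGB, H_f(G_fB − PGB)⟩ ≤ (2(ε + ε′ + εε′)Λ + 4Λρ + 2Λρ²)·nsq B` — route R6's (CONS)-class leg input with background, abstract form, every slack additive. [folklore] -/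
theorem energy_dist_minimisers_slack (hSc : Cc * Sc = 1) (hSf : Cf * Sf = 1) (hε : 0 ≤ ε) (hε' : 0 ≤ ε')
    (hprol : ∀ u : ι₀ → ℂ, (star (P *ᵥ u) ⬝ᵥ (Hf *ᵥ (P *ᵥ u))).re ≤ (1 + ε) * (star u ⬝ᵥ (Hc *ᵥ u)).re) (hG : Cc * G = 1) (B : κ → ℂ)
    (hmin : (star (G *ᵥ B) ⬝ᵥ (Hc *ᵥ (G *ᵥ B))).re ≤ (star B ⬝ᵥ (shortForm hHc.isHermitian Cc Sc *ᵥ B)).re)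
    (hmono : (star B ⬝ᵥ (shortForm hHc.isHermitian Cc Sc *ᵥ B)).re ≤ (1 + ε') * (star B ⬝ᵥ (shortForm hHf.isHermitian Cf Sf *ᵥ B)).re)
    {Gf : Matrix ι₁ κ ℂ} (hGf : Cf * Gf = 1) (hminf : (star (Gf *ᵥ B) ⬝ᵥ (Hf *ᵥ (Gf *ᵥ B))).re ≤ (star B ⬝ᵥ (shortForm hHf.isHermitian Cf Sf *ᵥ B)).re)
    {Λ ρ : ℝ} (hΛ : ‖shortForm hHf.isHermitian Cf Sf‖ ≤ Λ) (hρ : 0 ≤ ρ) (hδ : nsq (Cf *ᵥ (P *ᵥ (G *ᵥ B)) - B) ≤ ρ ^ 2 * nsq B) :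
    (star (Gf *ᵥ B - P *ᵥ (G *ᵥ B)) ⬝ᵥ (Hf *ᵥ (Gf *ᵥ B - P *ᵥ (G *ᵥ B)))).re
      ≤ (2 * (ε + ε' + ε * ε') * Λ + 4 * Λ * ρ + 2 * Λ * ρ ^ 2) * nsq B := by
  set Ef := shortForm hHf.isHermitian Cf Sf with hEf
  set r := Cf *ᵥ (P *ᵥ (G *ᵥ B)) - B with hr
  set t := trial hHc.isHermitian hHf.isHermitian Cc Sc Cf Sf P *ᵥ B with ht
  set h' := harmExt hHf.isHermitian Cf Sf *ᵥ B with hh'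
  set hj := harmExt hHc.isHermitian Cc Sc *ᵥ B with hhj
  set R := rowDefect hHc.isHermitian Cc Sc Cf P *ᵥ B with hR
  -- norm bounds
  have hcs := re_pairing_le_opNorm Ef B r
  have hcs2 := re_pairing_le_opNorm Ef r r
  have hcsB := re_pairing_le_opNorm Ef B B
  have hsq : Real.sqrt (nsq r) ≤ ρ * Real.sqrt (nsq B) := by
    calc Real.sqrt (nsq r) ≤ Real.sqrt (ρ ^ 2 * nsq B) := Real.sqrt_le_sqrt hδ
      _ = ρ * Real.sqrt (nsq B) := by rw [Real.sqrt_mul (sq_nonneg _), Real.sqrt_sq hρ]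
  have hΛ0 : 0 ≤ Λ := (norm_nonneg _).trans hΛ
  have hB0 : 0 ≤ Real.sqrt (nsq B) := Real.sqrt_nonneg _
  have hr0 : 0 ≤ Real.sqrt (nsq r) := Real.sqrt_nonneg _
  have hBB : Real.sqrt (nsq B) * Real.sqrt (nsq B) = nsq B := Real.mul_self_sqrt (nsq_nonneg B)
  have hmain : |(star B ⬝ᵥ (Ef *ᵥ r)).re| ≤ Λ * ρ * nsq B := by
    calc |(star B ⬝ᵥ (Ef *ᵥ r)).re| ≤ ‖Ef‖ * Real.sqrt (nsq B) * Real.sqrt (nsq r) := hcs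
      _ ≤ Λ * Real.sqrt (nsq B) * (ρ * Real.sqrt (nsq B)) := mul_le_mul (mul_le_mul_of_nonneg_right hΛ hB0) hsq hr0 (mul_nonneg hΛ0 hB0)
      _ = Λ * ρ * (Real.sqrt (nsq B) * Real.sqrt (nsq B)) := by ring
      _ = Λ * ρ * nsq B := by rw [hBB]
  have hmain2 : |(star r ⬝ᵥ (Ef *ᵥ r)).re| ≤ Λ * ρ ^ 2 * nsq B := by
    calc |(star r ⬝ᵥ (Ef *ᵥ r)).re| ≤ ‖Ef‖ * Real.sqrt (nsq r) * Real.sqrt (nsq r) := hcs2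
      _ ≤ Λ * (ρ * Real.sqrt (nsq B)) * (ρ * Real.sqrt (nsq B)) := mul_le_mul (mul_le_mul hΛ hsq hr0 hΛ0) hsq hr0 (mul_nonneg hΛ0 (mul_nonneg hρ hB0))
      _ = Λ * ρ ^ 2 * (Real.sqrt (nsq B) * Real.sqrt (nsq B)) := by ring
      _ = Λ * ρ ^ 2 * nsq B := by rw [hBB]
  have hEB : (star B ⬝ᵥ (Ef *ᵥ B)).re ≤ Λ * nsq B := by
    have h := (abs_le.mp hcsB).2
    calc (star B ⬝ᵥ (Ef *ᵥ B)).re ≤ ‖Ef‖ * Real.sqrt (nsq B) * Real.sqrt (nsq B) := h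
      _ ≤ Λ * Real.sqrt (nsq B) * Real.sqrt (nsq B) := mul_le_mul_of_nonneg_right (mul_le_mul_of_nonneg_right hΛ hB0) hB0
      _ = Λ * nsq B := by rw [mul_assoc, hBB]
  -- the energy distance of road P2's trial field and the energy of `harmExt_f R`
  have hdist := energy_dist_slack hHc hHf hSc hSf hε hprol hG B hmin hmono
  rw [← hEf, ← hr, ← ht, ← hh'] at hdist
  -- the null bracket and the decomposition
  have hK : Hf *ᵥ ((Gf *ᵥ B - h') + P *ᵥ (hj - G *ᵥ B)) = 0 := by
    rw [mulVec_add, show Gf *ᵥ B - h' = -(h' - Gf *ᵥ B) by abel, mulVec_neg, hh', H_harmExt_sub_mulVec_eq_zero hHf hSf hGf B hminf, neg_zero,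
      zero_add, hhj]
    exact Hf_P_mulVec_of_ker_slack hHf hprol (H_harmExt_sub_mulVec_eq_zero hHc hSc hG B hmin)
  have htr : t = P *ᵥ hj - harmExt hHf.isHermitian Cf Sf *ᵥ R := by
    rw [ht, trial, sub_mulVec, ← mulVec_mulVec, ← mulVec_mulVec, ← hhj, hR]
  have hX : Gf *ᵥ B - P *ᵥ (G *ᵥ B) = -((t - h') + harmExt hHf.isHermitian Cf Sf *ᵥ R) + ((Gf *ᵥ B - h') + P *ᵥ (hj - G *ᵥ B)) := by
    rw [htr, mulVec_sub]; abel
  have hnull : ∀ u k : ι₁ → ℂ, Hf *ᵥ k = 0 → star (u + k) ⬝ᵥ (Hf *ᵥ (u + k)) = star u ⬝ᵥ (Hf *ᵥ u) := fun u k hk => by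
    rw [mulVec_add, hk, add_zero, star_add, add_dotProduct, ker_pairing hHf.isHermitian hk u, add_zero]
  have hq1 : star (Gf *ᵥ B - P *ᵥ (G *ᵥ B)) ⬝ᵥ (Hf *ᵥ (Gf *ᵥ B - P *ᵥ (G *ᵥ B)))
      = star ((t - h') + harmExt hHf.isHermitian Cf Sf *ᵥ R) ⬝ᵥ (Hf *ᵥ ((t - h') + harmExt hHf.isHermitian Cf Sf *ᵥ R)) := by
    rw [hX, hnull _ _ hK, mulVec_neg, star_neg, neg_dotProduct, dotProduct_neg, neg_neg]
  have hq2 : ∀ a b : ι₁ → ℂ, (star (a + b) ⬝ᵥ (Hf *ᵥ (a + b))).re ≤ 2 * (star a ⬝ᵥ (Hf *ᵥ a)).re + 2 * (star b ⬝ᵥ (Hf *ᵥ b)).re := by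
    intro a b
    have hpar : star (a + b) ⬝ᵥ (Hf *ᵥ (a + b)) + star (a - b) ⬝ᵥ (Hf *ᵥ (a - b)) = 2 * (star a ⬝ᵥ (Hf *ᵥ a)) + 2 * (star b ⬝ᵥ (Hf *ᵥ b)) := by
      simp only [mulVec_add, mulVec_sub, star_add, star_sub, add_dotProduct, sub_dotProduct, dotProduct_add, dotProduct_sub]; ring
    have hre := congrArg Complex.re hpar
    simp only [Complex.add_re, Complex.mul_re, Complex.re_ofNat, Complex.im_ofNat, zero_mul, sub_zero] at hre
    have hnn : 0 ≤ (star (a - b) ⬝ᵥ (Hf *ᵥ (a - b))).re := (Complex.nonneg_iff.mp (hHf.dotProduct_mulVec_nonneg _)).1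
    linarith
  have hq3 : star (harmExt hHf.isHermitian Cf Sf *ᵥ R) ⬝ᵥ (Hf *ᵥ (harmExt hHf.isHermitian Cf Sf *ᵥ R)) = star r ⬝ᵥ (Ef *ᵥ r) := by
    rw [← shortForm_quad, hR, hEf, hr, ← rowDefect_quad_eq_slack hHc hHf hSc hSf hprol hG B hmin]
  have hab := (abs_le.mp hmain).1
  have hab2 := (abs_le.mp hmain2).2
  have hB2 : 0 ≤ nsq B := nsq_nonneg B
  have hslack0 : 0 ≤ ε + ε' + ε * ε' := by nlinarith
  have hx : (ε + ε' + ε * ε') * (star B ⬝ᵥ (Ef *ᵥ B)).re ≤ (ε + ε' + ε * ε') * (Λ * nsq B) := mul_le_mul_of_nonneg_left hEB hslack0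
  have hy : 0 ≤ Λ * ρ ^ 2 * nsq B := by positivity
  have hfin : (star (Gf *ᵥ B - P *ᵥ (G *ᵥ B)) ⬝ᵥ (Hf *ᵥ (Gf *ᵥ B - P *ᵥ (G *ᵥ B)))).re
      ≤ (2 * (ε + ε' + ε * ε') * Λ + 4 * Λ * ρ + 2 * Λ * ρ ^ 2) * nsq B := by
    rw [hq1]
    refine (hq2 _ _).trans ?_
    rw [hq3]
    linarith [hdist, hab, hab2, hx, hy]
  exact hfin

end Split

end Summit.QuantumFields.BalabanUV.Beta.GAN24.MonotoneSqueezeSlack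

end
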